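import Summits.NavierStokesRegularity.NavierStokesRegularity.Theorems.LinearLiouvilleSeven.Negative.NormalForm

/-!
# `LinearLiouvilleSeven`: the quotient by slice-wise constants is load-bearing (parasitic modes)

Negative-side support for crux stmt-NavierStokesRegularity-4054 (cdisprove seat). At the trivial
background `u = 0` the parasitic modes `v(t,x) = (a − t)⁻¹ e`, `q(t,x) = −(a − t)⁻² ⟪e, x⟫`
(`a ≥ 1`, `‖e‖ ≤ 1`; KNSS 2009 §1: `b(t)`, `−b′(t)·x`) are tempered classical Stokes solutions
(`paraV_paraQ_isTempered`), and seven of them with distinct (shift, direction) are linearly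
independent (`paraFamily_indep`). Consequences:

* (a) `linearLiouvilleSeven_false_without_quotient` — asking for a genuinely vanishing combination
  instead of one that is constant on slices makes the crux FALSE: any proof must use the quotient;
* (a′) `linearLiouvilleSeven_false_uniform_constant` — one constant `b` for all times instead of
  `b(t)` is FALSE as well: the slice constants must be allowed to move in time.

## References

* G. Koch, N. Nadirashvili, G. Seregin, V. Šverák, Acta Math. 203 (2009), §1 (parasitic solutions
  `b(t)`, `−b′(t)·x`), (1.4), Prop. 4.1, Remark 6.1. [KNSS2009]
* C. R. Doering, J. D. Gibbon, *Applied Analysis of the Navier–Stokes Equations*, CUP 1995, §9.3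
  (9.3.2) (the linearised system). [DoeringGibbon1995]
-/

noncomputable section

open Set Function MeasureTheory InnerProductSpace
open scoped Laplacian ContDiff Topology RealInnerProductSpace BigOperators

set_option linter.dupNamespace false

namespace Summit.NavierStokesRegularity.NavierStokesRegularity.Theorems.LinearLiouvilleSeven.Negative

open Literature.Analysis Literature.Analysis.FluidPDE
open Summit.NavierStokesRegularity.NavierStokesRegularity.Theses.SymmetryModuliCount

/-! ## Load-bearing (a): the quotient by slice-wise constants

Dropping "modulo slice-constants" from the conclusion (asking for a genuinely vanishing
combination) makes the statement FALSE already at `u = 0`: the parasitic modes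
`v(t,x) = (a − t)⁻¹ e`, `q(t,x) = −(a − t)⁻² ⟪e, x⟫` (`a ≥ 1`, `‖e‖ ≤ 1`) are tempered classical
Stokes solutions, and seven of them with distinct (profile, direction) are linearly independent. -/

/-- Parasitic (spatially constant) linear mode in direction `e` with time profile `(a − t)⁻¹`. -/
def paraV (a : ℝ) (e : E3) : ℝ → E3 → E3 := fun t _ => (a - t)⁻¹ • e

/-- Its pressure `q(t,x) = −(a − t)⁻² ⟪e, x⟫`, so that `∂ₜ v = −∇q`. -/
def paraQ (a : ℝ) (e : E3) : ℝ → E3 → ℝ := fun t x => -((a - t)⁻¹ ^ 2 * ⟪e, x⟫)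

/-- Slices of the parasitic mode are constant. -/
theorem paraV_apply (a : ℝ) (e : E3) (t : ℝ) : paraV a e t = fun _ => (a - t)⁻¹ • e := rfl

/-- Unfolding the parasitic pressure. -/
theorem paraQ_apply (a : ℝ) (e : E3) (t : ℝ) :
    paraQ a e t = fun x => -((a - t)⁻¹ ^ 2 * ⟪e, x⟫) := rfl

/-- `∇⟪w, ·⟫ = w`. -/
theorem gradient_inner_const_left (w x : E3) : gradient (fun y : E3 => ⟪w, y⟫) x = w := by
  refine HasGradientAt.gradient ?_
  rw [hasGradientAt_iff_hasFDerivAt]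
  exact (InnerProductSpace.toDual ℝ E3 w).hasFDerivAt

/-- `√(−t)³ ≤ (a − t)²` for `t < 0`, `1 ≤ a` (used for the pressure growth of the parasitic and
strain modes). -/
theorem sqrt_neg_pow_three_le {a t : ℝ} (ha : 1 ≤ a) (ht : t < 0) :
    Real.sqrt (-t) ^ 3 ≤ (a - t) ^ 2 := by
  set s := Real.sqrt (-t) with hs
  have hs0 : 0 ≤ s := Real.sqrt_nonneg _
  have hs2 : s ^ 2 = -t := by rw [hs, Real.sq_sqrt]; linarith
  have hat : a - t = a + s ^ 2 := by linarith
  rw [hat]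
  nlinarith [mul_nonneg (sq_nonneg s) (sq_nonneg (s - 1)), mul_nonneg hs0 (sq_nonneg s),
    sq_nonneg (s ^ 2), mul_nonneg (by linarith : (0:ℝ) ≤ a - 1) (sq_nonneg s)]

/-- `(t, x) ↦ (a − t)⁻¹` is smooth on `(−∞,0) × ℝ³` for `0 ≤ a`. -/
theorem contDiffOn_inv_sub_fst {a : ℝ} (ha : 0 ≤ a) :
    ContDiffOn ℝ (⊤ : ℕ∞) (fun p : ℝ × E3 => (a - p.1)⁻¹) (Set.Iio 0 ×ˢ Set.univ) := by
  refine ContDiffOn.inv (contDiffOn_const.sub contDiffOn_fst) ?_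
  rintro ⟨t, x⟩ ⟨ht, -⟩
  simp only [Set.mem_Iio] at ht
  show a - t ≠ 0
  linarith

/-- **Parasitic modes are tempered classical Stokes solutions** (`a ≥ 1`, `‖e‖ ≤ 1`; growth constant `1`). -/
theorem paraV_paraQ_isTempered {a : ℝ} (ha : 1 ≤ a) {e : E3} (he : ‖e‖ ≤ 1) :
    IsTemperedLinearisedNSSolution (0 : ℝ → E3 → E3) (paraV a e) (paraQ a e) where
  smooth_velocity := by
    change ContDiffOn ℝ (⊤ : ℕ∞) (fun p : ℝ × E3 => (a - p.1)⁻¹ • e) (Set.Iio 0 ×ˢ Set.univ)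
    exact (contDiffOn_inv_sub_fst (by linarith)).smul contDiffOn_const
  smooth_pressure := by
    change ContDiffOn ℝ (⊤ : ℕ∞) (fun p : ℝ × E3 => -((a - p.1)⁻¹ ^ 2 * ⟪e, p.2⟫))
      (Set.Iio 0 ×ˢ Set.univ)
    exact (((contDiffOn_inv_sub_fst (by linarith)).pow 2).mul
      (contDiffOn_const.inner ℝ contDiffOn_snd)).neg
  growth := by
    refine ⟨1, fun t ht x => ⟨?_, ?_⟩⟩
    · have hat : 0 < a - t := by linarith
      have hnt : 0 < -t := by linarith
      show ‖(a - t)⁻¹ • e‖ ≤ _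
      rw [norm_smul, Real.norm_eq_abs, abs_of_pos (inv_pos.2 hat)]
      calc (a - t)⁻¹ * ‖e‖ ≤ (a - t)⁻¹ * 1 := by gcongr
        _ ≤ (-t)⁻¹ := by rw [mul_one]; exact inv_anti₀ hnt (by linarith)
        _ = 1 * (1 + 0) / (-t) := by ring
        _ ≤ 1 * (1 + ‖x‖) / (-t) := by gcongr; exact norm_nonneg _
        _ ≤ 1 / Real.sqrt (-t) + 1 * (1 + ‖x‖) / (-t) := le_add_of_nonneg_left (by positivity)
    · have hat : 0 < a - t := by linarith
      have hnt : 0 < -t := by linarith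
      have hs3 : 0 < Real.sqrt (-t) ^ 3 := pow_pos (Real.sqrt_pos.2 hnt) 3
      show |-((a - t)⁻¹ ^ 2 * ⟪e, x⟫)| ≤ _
      rw [abs_neg, abs_mul, abs_of_nonneg (by positivity : (0:ℝ) ≤ (a - t)⁻¹ ^ 2)]
      have h1 : |⟪e, x⟫| ≤ ‖x‖ := by
        calc |⟪e, x⟫| ≤ ‖e‖ * ‖x‖ := abs_real_inner_le_norm e x
          _ ≤ 1 * ‖x‖ := by gcongr
          _ = ‖x‖ := one_mul _
      have h2 : (a - t)⁻¹ ^ 2 ≤ 1 / Real.sqrt (-t) ^ 3 := by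
        rw [inv_pow, ← one_div]
        exact one_div_le_one_div_of_le hs3 (sqrt_neg_pow_three_le ha ht)
      calc (a - t)⁻¹ ^ 2 * |⟪e, x⟫| ≤ (1 / Real.sqrt (-t) ^ 3) * ‖x‖ := by gcongr
        _ ≤ (1 / Real.sqrt (-t) ^ 3) * (1 + ‖x‖) := by gcongr; linarith
        _ = 1 * (1 + ‖x‖) / Real.sqrt (-t) ^ 3 := by ring
        _ ≤ 1 / (-t) + 1 * (1 + ‖x‖) / Real.sqrt (-t) ^ 3 := le_add_of_nonneg_left (by positivity)
  divFree := fun t _ x => by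
    simp [VectorCalculus.divergence, paraV_apply]
  momentum := fun t ht x => by
    have hat : a - t ≠ 0 := by intro h; linarith
    have e1 : timeDeriv (paraV a e) t x = ((a - t)⁻¹ ^ 2) • e := by
      simp only [timeDeriv, paraV_apply]
      exact ((hasDerivAt_inv_sub hat).smul_const e).deriv
    have e2 : convect ((0 : ℝ → E3 → E3) t) (paraV a e t) x = 0 := by simp [convect]
    have e3 : convect (paraV a e t) ((0 : ℝ → E3 → E3) t) x = 0 := by simp [convect]
    have e4 : Δ (paraV a e t) x = 0 := by
      rw [paraV_apply, InnerProductSpace.laplacian_const, Pi.zero_apply]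
    have e5 : gradient (paraQ a e t) x = (-((a - t)⁻¹ ^ 2)) • e := by
      have : paraQ a e t = fun y : E3 => ⟪(-((a - t)⁻¹ ^ 2)) • e, y⟫ := by
        funext y; simp only [paraQ_apply, real_inner_smul_left, neg_mul]
      rw [this, gradient_inner_const_left]
    rw [e1, e2, e3, e4, e5, add_zero, add_zero, neg_smul, zero_sub, neg_neg]

/-- Seven shifts `a ∈ {1,2,3}` … -/
def shift7 : Fin 7 → ℝ := ![1, 1, 1, 2, 2, 2, 3]
/-- … and directions `e_{dir}`: the seven pairs (shift, dir) are distinct. -/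
def dir7 : Fin 7 → Fin 3 := ![0, 1, 2, 0, 1, 2, 0]

/-- The seven parasitic modes. -/
def paraFamilyV (i : Fin 7) : ℝ → E3 → E3 := paraV (shift7 i) (EuclideanSpace.single (dir7 i) 1)
/-- Their pressures. -/
def paraFamilyQ (i : Fin 7) : ℝ → E3 → ℝ := paraQ (shift7 i) (EuclideanSpace.single (dir7 i) 1)

/-- All seven shifts are `≥ 1`. -/
theorem one_le_shift7 (i : Fin 7) : 1 ≤ shift7 i := by
  fin_cases i <;> simp [shift7]

/-- Unfolding the seven parasitic modes. -/
theorem paraFamilyV_apply (i : Fin 7) (t : ℝ) (x : E3) :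
    paraFamilyV i t x = (shift7 i - t)⁻¹ • EuclideanSpace.single (dir7 i) 1 := rfl

/-- Each of the seven parasitic modes is a tempered Stokes solution about `u = 0`. -/
theorem paraFamily_isTempered (i : Fin 7) :
    IsTemperedLinearisedNSSolution (0 : ℝ → E3 → E3) (paraFamilyV i) (paraFamilyQ i) :=
  paraV_paraQ_isTempered (one_le_shift7 i) (by simp)

/-- The seven parasitic modes are linearly independent as space–time fields (three time samples
suffice). -/
theorem paraFamily_indep (c : Fin 7 → ℝ)
    (h : ∀ t < 0, ∀ x : E3, ∑ i, c i • paraFamilyV i t x = 0) : c = 0 := by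
  have k01 := congrArg (fun w : E3 => ⟪EuclideanSpace.single (0 : Fin 3) (1 : ℝ), w⟫) (h (-1) (by norm_num) 0)
  have k02 := congrArg (fun w : E3 => ⟪EuclideanSpace.single (0 : Fin 3) (1 : ℝ), w⟫) (h (-2) (by norm_num) 0)
  have k03 := congrArg (fun w : E3 => ⟪EuclideanSpace.single (0 : Fin 3) (1 : ℝ), w⟫) (h (-3) (by norm_num) 0)
  have k11 := congrArg (fun w : E3 => ⟪EuclideanSpace.single (1 : Fin 3) (1 : ℝ), w⟫) (h (-1) (by norm_num) 0)
  have k12 := congrArg (fun w : E3 => ⟪EuclideanSpace.single (1 : Fin 3) (1 : ℝ), w⟫) (h (-2) (by norm_num) 0)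
  have k21 := congrArg (fun w : E3 => ⟪EuclideanSpace.single (2 : Fin 3) (1 : ℝ), w⟫) (h (-1) (by norm_num) 0)
  have k22 := congrArg (fun w : E3 => ⟪EuclideanSpace.single (2 : Fin 3) (1 : ℝ), w⟫) (h (-2) (by norm_num) 0)
  simp [Fin.sum_univ_seven, paraFamilyV_apply, shift7, dir7, inner_add_right, inner_smul_right,
    EuclideanSpace.inner_single_left] at k01 k02 k03 k11 k12 k21 k22
  norm_num at k01 k02 k03 k11 k12 k21 k22
  funext i
  fin_cases i <;> simp <;> linarith

/-- The crux WITHOUT the quotient: a genuinely vanishing nontrivial combination. -/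
def LinearLiouvilleSevenWithoutQuotient : Prop :=
  ∀ C u, InClassA C u → ∀ v q, SevenTempered u v q →
    ∃ c : Fin 7 → ℝ, c ≠ 0 ∧ ∀ t < 0, ∀ x, ∑ i, c i • v i t x = 0

/-- **Load-bearing (a).** Any proof of the crux must use the quotient by slice-wise constants:
without it the statement fails at `u = 0` (parasitic modes `b(t) = (a−t)⁻¹e`, `q = −b'·x`). -/
theorem linearLiouvilleSeven_false_without_quotient : ¬ LinearLiouvilleSevenWithoutQuotient := by
  intro h
  obtain ⟨c, hc, hzero⟩ := h 0 0 (inClassA_zero le_rfl) paraFamilyV paraFamilyQ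
    ((sevenTempered_iff 0 _ _).2 paraFamily_isTempered)
  exact hc (paraFamily_indep c hzero)



/-- **A natural strengthening refuted: one constant for all times.** Replacing the slice-wise
constants `b(t)` of the conclusion by a single vector `b` is FALSE at `u = 0` (same parasitic
family; four time samples). -/
def LinearLiouvilleSevenUniformConstant : Prop :=
  ∀ C u, InClassA C u → ∀ v q, SevenTempered u v q →
    ∃ c : Fin 7 → ℝ, c ≠ 0 ∧ ∃ b : E3, ∀ t < 0, ∀ x, ∑ i, c i • v i t x = b

/-- If a combination of the parasitic family is ONE constant for all times, it is trivial (four time samples). -/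
theorem paraFamily_indep_uniform (c : Fin 7 → ℝ) (b : E3)
    (h : ∀ t < 0, ∀ x : E3, ∑ i, c i • paraFamilyV i t x = b) : c = 0 := by
  have k01 := congrArg (fun w : E3 => ⟪EuclideanSpace.single (0 : Fin 3) (1 : ℝ), w⟫) (h (-1) (by norm_num) 0)
  have k02 := congrArg (fun w : E3 => ⟪EuclideanSpace.single (0 : Fin 3) (1 : ℝ), w⟫) (h (-2) (by norm_num) 0)
  have k03 := congrArg (fun w : E3 => ⟪EuclideanSpace.single (0 : Fin 3) (1 : ℝ), w⟫) (h (-3) (by norm_num) 0)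
  have k04 := congrArg (fun w : E3 => ⟪EuclideanSpace.single (0 : Fin 3) (1 : ℝ), w⟫) (h (-4) (by norm_num) 0)
  have k11 := congrArg (fun w : E3 => ⟪EuclideanSpace.single (1 : Fin 3) (1 : ℝ), w⟫) (h (-1) (by norm_num) 0)
  have k12 := congrArg (fun w : E3 => ⟪EuclideanSpace.single (1 : Fin 3) (1 : ℝ), w⟫) (h (-2) (by norm_num) 0)
  have k13 := congrArg (fun w : E3 => ⟪EuclideanSpace.single (1 : Fin 3) (1 : ℝ), w⟫) (h (-3) (by norm_num) 0)
  have k21 := congrArg (fun w : E3 => ⟪EuclideanSpace.single (2 : Fin 3) (1 : ℝ), w⟫) (h (-1) (by norm_num) 0)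
  have k22 := congrArg (fun w : E3 => ⟪EuclideanSpace.single (2 : Fin 3) (1 : ℝ), w⟫) (h (-2) (by norm_num) 0)
  have k23 := congrArg (fun w : E3 => ⟪EuclideanSpace.single (2 : Fin 3) (1 : ℝ), w⟫) (h (-3) (by norm_num) 0)
  simp [Fin.sum_univ_seven, paraFamilyV_apply, shift7, dir7, inner_add_right, inner_smul_right,
    EuclideanSpace.inner_single_left] at k01 k02 k03 k04 k11 k12 k13 k21 k22 k23
  norm_num at k01 k02 k03 k04 k11 k12 k13 k21 k22 k23
  funext i
  fin_cases i <;> simp <;> linarith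

/-- **Strengthening refuted (a′).** The slice constants of the conclusion cannot be taken independent of `t`. -/
theorem linearLiouvilleSeven_false_uniform_constant : ¬ LinearLiouvilleSevenUniformConstant := by
  intro h
  obtain ⟨c, hc, b, hb⟩ := h 0 0 (inClassA_zero le_rfl) paraFamilyV paraFamilyQ
    ((sevenTempered_iff 0 _ _).2 paraFamily_isTempered)
  exact hc (paraFamily_indep_uniform c b hb)


end Summit.NavierStokesRegularity.NavierStokesRegularity.Theorems.LinearLiouvilleSeven.Negative

end
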